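import Summits.CriticalPhenomena.PercolationContinuityZ3.Theorems.PercNearOneGluingNoHeavyLowerTailThreePointIsoProduct
import HarnessLib

/-!
# The HUB STEP for the sharpened three-point row `(3PT+)`, and `(3PT+)` for all hub laws

Support file for crux `stmt-CriticalPhenomena-4575` (`NoHeavyLowerTail`), lane `prim-facecert` gen 18
(`--supports stmt-CriticalPhenomena-4575`).  Memos: `run/shared/lean/prim/prim-l12/FROM-prim-nh-lead-4575-g112-3PTPLUS-HUB.md`
(the lead's reduction of THEOREM H⁺ to a one-hub step, §4/§8) and `run/shared/lean/prim/prim-l12/prim-facecert/FINDING-gen18-HUB-STEP-CERTIFICATE.md`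
(this certificate).

Coordinates as in `…ThreePointIsoProduct`: for a three-terminal law, `Q = P(sep)`, `A = P(c isolated)`, `B = P(b isolated)`,
`C = P(a isolated)`; cells `x = P(abc) = 1 − (A+B+C−2Q)`, `s = P(ab|c) = A − Q`, `t = P(ac|b) = B − Q`, `u = P(bc|a) = C − Q`,
`q = Q`.  The sharpened row of `…ThreePointPlusLeFive`,

  `(3PT+)   x(1−x) ≤ t + u + 2xs`,   equivalently   `2Q − A ≤ (B + C − A)(A + B + C − 2Q)`,

implies the variance row `(3PT)` (`(3PT) = (3PT+) + s²`).  Parallel composition at the terminals multiplies `(Q,A,B,C)`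
coordinatewise; one hub `h` joined to `a, b, c` with probabilities `α, β, γ` multiplies by
`(1−αβ−αγ−βγ+2αβγ, 1−γ(α+β−αβ), 1−β(α+γ−αγ), 1−α(β+γ−βγ))`.  THIS FILE proves [this work]:

* `kShadow`: the isolation criterion `(K_A) Q³ ≤ A²BC` implies the QUADRATIC shadow `27(2Q − A) ≤ 32·BC`
  (sharp: `max_P P(2Q − cP)² = 32Q³/(27c)`);
* `hubStep_cells` / `hubStep`: the HUB STEP — if a law satisfies `(3PT+)` and the shadow, its composition with any hub satisfies
  `(3PT+)`.  The proof is an EXACT POLYNOMIAL CERTIFICATE found by linear programming (kit job `j187549`, 405 × 459, exact rational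
  reconstruction): the `(3PT+)`-margin of the composite is a combination with positive rational coefficients (denominators `≤ 27`
  after clearing the Bernstein binomials) of products `(cell monomial) × (tensor-Bernstein element of bidegree (2,2,2) in α,β,γ) ×
  {1, M, R}`, `M` = the `(3PT+)`-margin of the law, `R = 32BC − 27(2Q−A)`; `ring` checks the identity and `positivity` the signs.
  Read by Bernstein element the certificate says: the pure-`M` corner blocks, `Λ_B = 2B(B+C−Q) − (2Q−A)` and
  `Λ_C = 2C(B+C−Q) − (2Q−A)` on the single-edge blocks (`27Λ_C = R + 22q² + 76uq + 54u² + 22tq + 22tu`), `2BC − (2Q−A)` on the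
  `ac ∧ bc` block, `s(1−A)`, `s`, `A(1−A)`, `A`, `B²`, `C²` on the `ab`-blocks, and one mixed block.  Numerically the step is FALSE
  without `(K_A)` (a `bc`-edge applied to `(x,s,t,u,q) = (.79, 0, .16, 0, .04)`), so the shadow is essential;
* `inv_step`, `inv_prod`: `(3PT+) ∧ (K_A) ∧ realizability` is preserved by hub steps (with `star_isoK_A` and the product
  closure of `(K_A)` from `…ThreePointIsoProduct`), hence holds for every finite product of hubs;
* `threePointPlus_hubTriLaw`: `(3PT+)` in isolation coordinates for the law of every weighted `K_{3,k}` plus arbitrary terminal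
  edges (a terminal edge is the degenerate hub `(p,1,0)`, `(p,0,1)` or `(0,p,1)`).

The percolation wrapper (`(3PT+)` as an inequality between `prodBernoulli` probabilities on every hub graph) is the companion file
`…ThreePointPlusHubGraphs`.  Not here: anything beyond hub graphs — `(3PT+)` and `(3PT)` are FALSE for general graphs
(`prim-l12-p6` gen 22, hub-chain gadget), and the semigroup conjecture `𝒞_K` of the lead's memo §3 is not addressed.
-/

namespace Summit.CriticalPhenomena.PercolationContinuityZ3.Theorems.ThreePointPlusIsoProduct

open Summit.CriticalPhenomena.PercolationContinuityZ3.Theorems.ThreePointIsoProduct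

/-! ## The quadratic shadow of `(K_A)` -/

/-- **`(K_A) ⟹ 27(2Q−A) ≤ 32BC`.**  For `Q, A, B, C ≥ 0` with `Q³ ≤ A²BC`: `27(2Q − A) ≤ 32BC`.  Proof: with `P = BC`,
`729Q³ − P(54Q − 32P)² = (16P − 9Q)²(9Q − 4P)`, so for `32P < 54Q` one has `P(54Q−32P)² ≤ 729Q³ ≤ 729A²P`. [this work] -/
theorem kShadow {Q A B C : ℝ} (hQ : 0 ≤ Q) (hA : 0 ≤ A) (hB : 0 ≤ B) (hC : 0 ≤ C) (hK : Q ^ 3 ≤ A ^ 2 * B * C) :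
    27 * (2 * Q - A) ≤ 32 * (B * C) := by
  set P := B * C with hP
  have hP0 : 0 ≤ P := mul_nonneg hB hC
  have hK' : Q ^ 3 ≤ A ^ 2 * P := by rw [hP, ← mul_assoc]; exact hK
  by_cases h1 : 54 * Q ≤ 32 * P
  · nlinarith
  push Not at h1
  have key : 729 * Q ^ 3 - P * (54 * Q - 32 * P) ^ 2 = (16 * P - 9 * Q) ^ 2 * (9 * Q - 4 * P) := by ring
  have h9 : 0 ≤ 9 * Q - 4 * P := by linarith
  have h3 : P * (54 * Q - 32 * P) ^ 2 ≤ 729 * (A ^ 2 * P) := by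
    nlinarith [mul_nonneg (sq_nonneg (16 * P - 9 * Q)) h9]
  by_contra hc
  push Not at hc
  -- `27A < 54Q − 32P`, both sides of the square comparison are then ordered
  have h27 : 0 ≤ 27 * A := by linarith
  have h4 : (27 * A) ^ 2 < (54 * Q - 32 * P) ^ 2 := by nlinarith
  -- `P · ((54Q−32P)² − 729A²) ≤ 0` with a positive bracket forces `P = 0`
  have hPle : P ≤ 0 := by
    by_contra hp
    push Not at hp
    nlinarith [mul_lt_mul_of_pos_left h4 hp]
  have hP00 : P = 0 := le_antisymm hPle hP0
  have hQ3 : Q ^ 3 ≤ 0 := by rw [hP00] at hK'; simpa using hK'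
  have hQ0 : Q = 0 := le_antisymm (by nlinarith [pow_nonneg hQ 3, sq_nonneg Q, mul_nonneg hQ (sq_nonneg Q)]) hQ
  rw [hQ0, hP00] at hc
  linarith

/-! ## The hub step (certificate) -/

section cells
variable {x s t u q α β γ : ℝ}

/-- **The certificate identity** (pure `ring`): the homogeneous `(3PT+)`-margin of the composite cells of `L ∘ H(α,β,γ)`
(`q' = q·q_h`, `s' = q_h s + s_h(s+q)`, `t' = q_h t + t_h(t+q)`, `u' = q_h u + u_h(u+q)`,
`x' = x(q_h+s_h+t_h+u_h) + x_h(x+s+t+u+q) + s_h(t+u) + t_h(s+u) + u_h(s+t)` with the hub atoms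
`q_h = (1−α)(1−β)(1−γ)+α(1−β)(1−γ)+(1−α)β(1−γ)+(1−α)(1−β)γ`, `s_h = αβ(1−γ)`, `t_h = α(1−β)γ`, `u_h = (1−α)βγ`, `x_h = αβγ`)
equals the LP certificate (102 terms grouped by the 24 Bernstein elements that occur). [this work] -/
theorem cert_identity (x s t u q α β γ : ℝ) :
    let qh := (1 - α) * (1 - β) * (1 - γ) + α * (1 - β) * (1 - γ) + (1 - α) * β * (1 - γ) + (1 - α) * (1 - β) * γ
    let sh := α * β * (1 - γ)
    let th := α * (1 - β) * γ
    let uh := (1 - α) * β * γ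
    let xh := α * β * γ
    let x' := x * (qh + sh + th + uh) + xh * (x + s + t + u + q) + sh * (t + u) + th * (s + u) + uh * (s + t)
    let s' := qh * s + sh * (s + q)
    let t' := qh * t + th * (t + q)
    let u' := qh * u + uh * (u + q)
    let q' := qh * q
    (t' + u') * (t' + u' + q' + s') - (q' - s') * x' =
      (1 - α) ^ 2 * (1 - β) ^ 2 * (1 - γ) ^ 2 * (((t + u) * (t + u + q + s) - (q - s) * x))
      + (1 - α) ^ 2 * (1 - β) ^ 2 * γ * (1 - γ) * ((2 : ℝ) * ((t + u) * (t + u + q + s) - (q - s) * x))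
      + (1 - α) ^ 2 * (1 - β) ^ 2 * γ ^ 2 * (((t + u) * (t + u + q + s) - (q - s) * x))
      + (1 - α) ^ 2 * β * (1 - β) * (1 - γ) ^ 2 * ((2 : ℝ) * ((t + u) * (t + u + q + s) - (q - s) * x))
      + (1 - α) ^ 2 * β * (1 - β) * γ * (1 - γ) * ((2 : ℝ) * ((t + u) * (t + u + q + s) - (q - s) * x) + (1 / 27 : ℝ) * (32 * ((q + t) * (q + u)) - 27 * ((q - s) * (x + s + t + u + q))) + (22 / 27 : ℝ) * q ^ 2 + (76 / 27 : ℝ) * u * q + (2 : ℝ) * u ^ 2 + (22 / 27 : ℝ) * t * q + (22 / 27 : ℝ) * t * u)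
      + (1 - α) ^ 2 * β * (1 - β) * γ ^ 2 * ((1 / 27 : ℝ) * (32 * ((q + t) * (q + u)) - 27 * ((q - s) * (x + s + t + u + q))) + (22 / 27 : ℝ) * q ^ 2 + (76 / 27 : ℝ) * u * q + (2 : ℝ) * u ^ 2 + (22 / 27 : ℝ) * t * q + (22 / 27 : ℝ) * t * u)
      + (1 - α) ^ 2 * β ^ 2 * (1 - γ) ^ 2 * (((t + u) * (t + u + q + s) - (q - s) * x))
      + (1 - α) ^ 2 * β ^ 2 * γ * (1 - γ) * ((1 / 27 : ℝ) * (32 * ((q + t) * (q + u)) - 27 * ((q - s) * (x + s + t + u + q))) + (22 / 27 : ℝ) * q ^ 2 + (76 / 27 : ℝ) * u * q + (2 : ℝ) * u ^ 2 + (22 / 27 : ℝ) * t * q + (22 / 27 : ℝ) * t * u)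
      + (1 - α) ^ 2 * β ^ 2 * γ ^ 2 * (q ^ 2 + (2 : ℝ) * u * q + u ^ 2)
      + α * (1 - α) * (1 - β) ^ 2 * (1 - γ) ^ 2 * ((2 : ℝ) * ((t + u) * (t + u + q + s) - (q - s) * x))
      + α * (1 - α) * (1 - β) ^ 2 * γ * (1 - γ) * ((2 : ℝ) * ((t + u) * (t + u + q + s) - (q - s) * x) + (1 / 27 : ℝ) * (32 * ((q + t) * (q + u)) - 27 * ((q - s) * (x + s + t + u + q))) + (22 / 27 : ℝ) * q ^ 2 + (22 / 27 : ℝ) * u * q + (76 / 27 : ℝ) * t * q + (22 / 27 : ℝ) * t * u + (2 : ℝ) * t ^ 2)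
      + α * (1 - α) * (1 - β) ^ 2 * γ ^ 2 * ((1 / 27 : ℝ) * (32 * ((q + t) * (q + u)) - 27 * ((q - s) * (x + s + t + u + q))) + (22 / 27 : ℝ) * q ^ 2 + (22 / 27 : ℝ) * u * q + (76 / 27 : ℝ) * t * q + (22 / 27 : ℝ) * t * u + (2 : ℝ) * t ^ 2)
      + α * (1 - α) * β * (1 - β) * (1 - γ) ^ 2 * ((2 : ℝ) * ((t + u) * (t + u + q + s) - (q - s) * x) + (2 : ℝ) * s * u + (2 : ℝ) * s * t + (2 : ℝ) * x * s)
      + α * (1 - α) * β * (1 - β) * γ * (1 - γ) * ((2 / 9 : ℝ) * ((t + u) * (t + u + q + s) - (q - s) * x) + (1 / 9 : ℝ) * (32 * ((q + t) * (q + u)) - 27 * ((q - s) * (x + s + t + u + q))) + (4 / 9 : ℝ) * q ^ 2 + (20 / 9 : ℝ) * u * q + (16 / 9 : ℝ) * u ^ 2 + (20 / 9 : ℝ) * t * q + (16 / 9 : ℝ) * t ^ 2 + (16 / 9 : ℝ) * s * u + (16 / 9 : ℝ) * s * t + (2 / 9 : ℝ) * x * q + (16 / 9 : ℝ) * x * 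s)
      + α * (1 - α) * β * (1 - β) * γ ^ 2 * ((1 / 27 : ℝ) * (32 * ((q + t) * (q + u)) - 27 * ((q - s) * (x + s + t + u + q))) + (22 / 27 : ℝ) * q ^ 2 + (22 / 27 : ℝ) * u * q + (22 / 27 : ℝ) * t * q + (22 / 27 : ℝ) * t * u)
      + α * (1 - α) * β ^ 2 * (1 - γ) ^ 2 * ((2 : ℝ) * s * u + (2 : ℝ) * s * t + (2 : ℝ) * x * s)
      + α * (1 - α) * β ^ 2 * γ * (1 - γ) * ((2 : ℝ) * s * q + (2 : ℝ) * s * u + (2 : ℝ) * s * t + (2 : ℝ) * s ^ 2 + (2 : ℝ) * x * s)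
      + α ^ 2 * (1 - β) ^ 2 * (1 - γ) ^ 2 * (((t + u) * (t + u + q + s) - (q - s) * x))
      + α ^ 2 * (1 - β) ^ 2 * γ * (1 - γ) * ((1 / 27 : ℝ) * (32 * ((q + t) * (q + u)) - 27 * ((q - s) * (x + s + t + u + q))) + (22 / 27 : ℝ) * q ^ 2 + (22 / 27 : ℝ) * u * q + (76 / 27 : ℝ) * t * q + (22 / 27 : ℝ) * t * u + (2 : ℝ) * t ^ 2)
      + α ^ 2 * (1 - β) ^ 2 * γ ^ 2 * (q ^ 2 + (2 : ℝ) * t * q + t ^ 2)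
      + α ^ 2 * β * (1 - β) * (1 - γ) ^ 2 * ((2 : ℝ) * s * u + (2 : ℝ) * s * t + (2 : ℝ) * x * s)
      + α ^ 2 * β * (1 - β) * γ * (1 - γ) * ((2 : ℝ) * s * q + (2 : ℝ) * s * u + (2 : ℝ) * s * t + (2 : ℝ) * s ^ 2 + (2 : ℝ) * x * s)
      + α ^ 2 * β ^ 2 * (1 - γ) ^ 2 * (u * q + t * q + s * u + s * t + x * q + x * s)
      + α ^ 2 * β ^ 2 * γ * (1 - γ) * (q ^ 2 + u * q + t * q + (2 : ℝ) * s * q + s * u + s * t + s ^ 2 + x * q + x * s) := by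
  intro qh sh th uh xh x' s' t' u' q'
  simp only [qh, sh, th, uh, xh, x', s', t', u', q']
  ring

/-- **The hub step in cells.**  If the cells `x, s, t, u, q ≥ 0` of a law satisfy the `(3PT+)`-margin inequality
`0 ≤ (t+u)(t+u+q+s) − (q−s)x` and the shadow `0 ≤ 32(q+t)(q+u) − 27(q−s)(x+s+t+u+q)`, then for every hub `α, β, γ ∈ [0,1]`
the composite cells satisfy the `(3PT+)`-margin inequality. [this work] -/
theorem hubStep_cells (hx : 0 ≤ x) (hs : 0 ≤ s) (ht : 0 ≤ t) (hu : 0 ≤ u) (hq : 0 ≤ q) (hα : 0 ≤ α) (hα1 : α ≤ 1)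
    (hβ : 0 ≤ β) (hβ1 : β ≤ 1) (hγ : 0 ≤ γ) (hγ1 : γ ≤ 1) (hM : 0 ≤ (t + u) * (t + u + q + s) - (q - s) * x)
    (hR : 0 ≤ 32 * ((q + t) * (q + u)) - 27 * ((q - s) * (x + s + t + u + q))) :
    let qh := (1 - α) * (1 - β) * (1 - γ) + α * (1 - β) * (1 - γ) + (1 - α) * β * (1 - γ) + (1 - α) * (1 - β) * γ
    let sh := α * β * (1 - γ)
    let th := α * (1 - β) * γ
    let uh := (1 - α) * β * γ
    let xh := α * β * γ
    let x' := x * (qh + sh + th + uh) + xh * (x + s + t + u + q) + sh * (t + u) + th * (s + u) + uh * (s + t)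
    let s' := qh * s + sh * (s + q)
    let t' := qh * t + th * (t + q)
    let u' := qh * u + uh * (u + q)
    let q' := qh * q
    0 ≤ (t' + u') * (t' + u' + q' + s') - (q' - s') * x' := by
  have e := cert_identity x s t u q α β γ
  simp only at e ⊢
  rw [e]
  have ha := sub_nonneg.2 hα1
  have hb := sub_nonneg.2 hβ1
  have hc := sub_nonneg.2 hγ1
  positivity

end cells

/-! ## The hub step in isolation coordinates -/

section iso
variable {Q A B C α β γ : ℝ}

/-- **The hub step.**  If `0 ≤ Q ≤ A, B, C`, `A+B+C−2Q ≤ 1` (realizability), `(3PT+) 2Q − A ≤ (B+C−A)(A+B+C−2Q)` and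
`(K_A) Q³ ≤ A²BC`, then the product with one hub `(α, β, γ) ∈ [0,1]³` satisfies `(3PT+)`. [this work] -/
theorem hubStep (hQ : 0 ≤ Q) (hQA : Q ≤ A) (hQB : Q ≤ B) (hQC : Q ≤ C) (hreal : A + B + C - 2 * Q ≤ 1)
    (hα : 0 ≤ α) (hα1 : α ≤ 1) (hβ : 0 ≤ β) (hβ1 : β ≤ 1) (hγ : 0 ≤ γ) (hγ1 : γ ≤ 1)
    (hP : 2 * Q - A ≤ (B + C - A) * (A + B + C - 2 * Q)) (hK : Q ^ 3 ≤ A ^ 2 * B * C) :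
    2 * (Q * (1 - α * β - α * γ - β * γ + 2 * α * β * γ)) - A * (1 - γ * (α + β - α * β)) ≤
      (B * (1 - β * (α + γ - α * γ)) + C * (1 - α * (β + γ - β * γ)) - A * (1 - γ * (α + β - α * β))) *
        (A * (1 - γ * (α + β - α * β)) + B * (1 - β * (α + γ - α * γ)) + C * (1 - α * (β + γ - β * γ)) -
          2 * (Q * (1 - α * β - α * γ - β * γ + 2 * α * β * γ))) := by
  have hA : 0 ≤ A := hQ.trans hQA
  have hR := kShadow hQ hA (hQ.trans hQB) (hQ.trans hQC) hK
  have h := hubStep_cells (x := 1 - (A + B + C - 2 * Q)) (s := A - Q) (t := B - Q) (u := C - Q) (q := Q)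
    (α := α) (β := β) (γ := γ) (sub_nonneg.2 hreal) (sub_nonneg.2 hQA) (sub_nonneg.2 hQB) (sub_nonneg.2 hQC) hQ
    hα hα1 hβ hβ1 hγ hγ1 (by nlinarith [hP]) (by nlinarith [hR])
  simp only at h
  nlinarith [h]

/-- Realizability is preserved: `x' ≥ 0` for the composite. [this work] -/
theorem real_step (hQA : Q ≤ A) (hQB : Q ≤ B) (hQC : Q ≤ C) (hreal : A + B + C - 2 * Q ≤ 1)
    (hα : 0 ≤ α) (hα1 : α ≤ 1) (hβ : 0 ≤ β) (hβ1 : β ≤ 1) (hγ : 0 ≤ γ) (hγ1 : γ ≤ 1) :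
    A * (1 - γ * (α + β - α * β)) + B * (1 - β * (α + γ - α * γ)) + C * (1 - α * (β + γ - β * γ)) -
        2 * (Q * (1 - α * β - α * γ - β * γ + 2 * α * β * γ)) ≤ 1 := by
  have ha := sub_nonneg.2 hα1
  have hb := sub_nonneg.2 hβ1
  have hc := sub_nonneg.2 hγ1
  have hx := sub_nonneg.2 hreal
  have hs := sub_nonneg.2 hQA
  have ht := sub_nonneg.2 hQB
  have hu := sub_nonneg.2 hQC
  -- `1 − (A'+B'+C'−2Q') = x(1−x_h) + x_h + s_h(t+u) + t_h(s+u) + u_h(s+t)` with `x = 1 − (A+B+C−2Q)`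
  have key : 1 - (A * (1 - γ * (α + β - α * β)) + B * (1 - β * (α + γ - α * γ)) + C * (1 - α * (β + γ - β * γ)) -
      2 * (Q * (1 - α * β - α * γ - β * γ + 2 * α * β * γ))) =
      (1 - (A + B + C - 2 * Q)) * (1 - α * β * γ) + α * β * γ + α * β * (1 - γ) * ((B - Q) + (C - Q)) +
        α * (1 - β) * γ * ((A - Q) + (C - Q)) + (1 - α) * β * γ * ((A - Q) + (B - Q)) := by ring
  have h3 : 0 ≤ 1 - α * β * γ := by nlinarith [mul_le_mul hα1 (mul_le_one₀ hβ1 hγ hγ1) (mul_nonneg hβ hγ) zero_le_one]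
  have : 0 ≤ (1 - (A + B + C - 2 * Q)) * (1 - α * β * γ) + α * β * γ + α * β * (1 - γ) * ((B - Q) + (C - Q)) +
      α * (1 - β) * γ * ((A - Q) + (C - Q)) + (1 - α) * β * γ * ((A - Q) + (B - Q)) := by positivity
  linarith

end iso

/-! ## The invariant and products -/

/-! The inductive invariant of a partial product `(Q, A, B, C)` is the conjunction
`0 ≤ Q ∧ Q ≤ A ∧ Q ≤ B ∧ Q ≤ C ∧ A+B+C−2Q ≤ 1 ∧ (3PT+) ∧ (K_A)` (written out, no new definition). -/

/-- The trivial law `(1,1,1,1)` (no hub) satisfies the invariant. [this work] -/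
theorem inv_one : (0:ℝ) ≤ 1 ∧ (1:ℝ) ≤ 1 ∧ (1:ℝ) ≤ 1 ∧ (1:ℝ) ≤ 1 ∧ (1:ℝ) + 1 + 1 - 2 * 1 ≤ 1 ∧
    2 * (1:ℝ) - 1 ≤ (1 + 1 - 1) * (1 + 1 + 1 - 2 * 1) ∧ (1:ℝ) ^ 3 ≤ 1 ^ 2 * 1 * 1 :=
  ⟨zero_le_one, le_rfl, le_rfl, le_rfl, by norm_num, by norm_num, by norm_num⟩

/-- **One hub preserves the invariant.** [this work] -/
theorem inv_step {Q A B C α β γ : ℝ}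
    (h : 0 ≤ Q ∧ Q ≤ A ∧ Q ≤ B ∧ Q ≤ C ∧ A + B + C - 2 * Q ≤ 1 ∧ 2 * Q - A ≤ (B + C - A) * (A + B + C - 2 * Q) ∧
      Q ^ 3 ≤ A ^ 2 * B * C)
    (hα : 0 ≤ α) (hα1 : α ≤ 1) (hβ : 0 ≤ β) (hβ1 : β ≤ 1) (hγ : 0 ≤ γ) (hγ1 : γ ≤ 1) :
    let Q' := Q * (1 - α * β - α * γ - β * γ + 2 * α * β * γ)
    let A' := A * (1 - γ * (α + β - α * β))
    let B' := B * (1 - β * (α + γ - α * γ))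
    let C' := C * (1 - α * (β + γ - β * γ))
    0 ≤ Q' ∧ Q' ≤ A' ∧ Q' ≤ B' ∧ Q' ≤ C' ∧ A' + B' + C' - 2 * Q' ≤ 1 ∧
      2 * Q' - A' ≤ (B' + C' - A') * (A' + B' + C' - 2 * Q') ∧ Q' ^ 3 ≤ A' ^ 2 * B' * C' := by
  intro Q' A' B' C'
  obtain ⟨hQ, hQA, hQB, hQC, hreal, plus, kA⟩ := h
  have hqh := star_Q_nonneg hα hα1 hβ hβ1 hγ hγ1
  have hA : 0 ≤ A := hQ.trans hQA
  have hB : 0 ≤ B := hQ.trans hQB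
  have hC : 0 ≤ C := hQ.trans hQC
  refine ⟨mul_nonneg hQ hqh, ?_, ?_, ?_, real_step hQA hQB hQC hreal hα hα1 hβ hβ1 hγ hγ1,
    hubStep hQ hQA hQB hQC hreal hα hα1 hβ hβ1 hγ hγ1 plus kA, ?_⟩
  · exact mul_le_mul hQA (star_Q_le_A hα hβ hγ1) hqh hA
  · exact mul_le_mul hQB (star_Q_le_B hα hγ hβ1) hqh hB
  · exact mul_le_mul hQC (star_Q_le_C hβ hγ hα1) hqh hC
  · have hk := star_isoK_A hα hα1 hβ hβ1 hγ hγ1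
    calc (Q * (1 - α * β - α * γ - β * γ + 2 * α * β * γ)) ^ 3
        = Q ^ 3 * (1 - α * β - α * γ - β * γ + 2 * α * β * γ) ^ 3 := by ring
      _ ≤ (A ^ 2 * B * C) * ((1 - γ * (α + β - α * β)) ^ 2 * (1 - β * (α + γ - α * γ)) * (1 - α * (β + γ - β * γ))) :=
          mul_le_mul kA hk (pow_nonneg hqh 3) (mul_nonneg (mul_nonneg (sq_nonneg A) hB) hC)
      _ = _ := by ring

section products
variable {ι : Type*} (S : Finset ι) (α β γ : ι → ℝ)

/-- **Every finite product of hubs satisfies the invariant.** [this work] -/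
theorem inv_prod [DecidableEq ι] (h01 : ∀ i ∈ S, 0 ≤ α i ∧ α i ≤ 1 ∧ 0 ≤ β i ∧ β i ≤ 1 ∧ 0 ≤ γ i ∧ γ i ≤ 1) :
    let PQ := ∏ i ∈ S, (1 - α i * β i - α i * γ i - β i * γ i + 2 * α i * β i * γ i)
    let PA := ∏ i ∈ S, (1 - γ i * (α i + β i - α i * β i))
    let PB := ∏ i ∈ S, (1 - β i * (α i + γ i - α i * γ i))
    let PC := ∏ i ∈ S, (1 - α i * (β i + γ i - β i * γ i))
    0 ≤ PQ ∧ PQ ≤ PA ∧ PQ ≤ PB ∧ PQ ≤ PC ∧ PA + PB + PC - 2 * PQ ≤ 1 ∧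
      2 * PQ - PA ≤ (PB + PC - PA) * (PA + PB + PC - 2 * PQ) ∧ PQ ^ 3 ≤ PA ^ 2 * PB * PC := by
  induction S using Finset.induction_on with
  | empty => simpa using inv_one
  | @insert i S hi ih =>
    simp only [Finset.prod_insert hi]
    have hS : ∀ j ∈ S, 0 ≤ α j ∧ α j ≤ 1 ∧ 0 ≤ β j ∧ β j ≤ 1 ∧ 0 ≤ γ j ∧ γ j ≤ 1 :=
      fun j hj => h01 j (Finset.mem_insert_of_mem hj)
    obtain ⟨h1, h2, h3, h4, h5, h6⟩ := h01 i (Finset.mem_insert_self i S)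
    have h := inv_step (ih hS) h1 h2 h3 h4 h5 h6
    simp only at h
    rw [mul_comm] at h
    rwa [mul_comm (∏ j ∈ S, (1 - γ j * (α j + β j - α j * β j))), mul_comm (∏ j ∈ S, (1 - β j * (α j + γ j - α j * γ j))),
      mul_comm (∏ j ∈ S, (1 - α j * (β j + γ j - β j * γ j)))] at h

/-- **`(3PT+)` for the law of `K_{3,S}` with arbitrary terminal edges**, in isolation coordinates: with the hub products
`PQ, PA, PB, PC` and terminal edge probabilities `pab, pac, pbc ∈ [0,1]`, the law `Q = (1−pab)(1−pac)(1−pbc)·PQ`,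
`A = (1−pac)(1−pbc)·PA`, `B = (1−pab)(1−pbc)·PB`, `C = (1−pab)(1−pac)·PC` satisfies `2Q − A ≤ (B+C−A)(A+B+C−2Q)`.
(A terminal edge is a degenerate hub: `ab = (p,1,0)`, `ac = (p,0,1)`, `bc = (0,p,1)`.) [this work] -/
theorem threePointPlus_hubTriLaw [DecidableEq ι] {pab pac pbc : ℝ} (hpab : 0 ≤ pab) (hpab1 : pab ≤ 1)
    (hpac : 0 ≤ pac) (hpac1 : pac ≤ 1) (hpbc : 0 ≤ pbc) (hpbc1 : pbc ≤ 1)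
    (h01 : ∀ i ∈ S, 0 ≤ α i ∧ α i ≤ 1 ∧ 0 ≤ β i ∧ β i ≤ 1 ∧ 0 ≤ γ i ∧ γ i ≤ 1) :
    let PQ := ∏ i ∈ S, (1 - α i * β i - α i * γ i - β i * γ i + 2 * α i * β i * γ i)
    let PA := ∏ i ∈ S, (1 - γ i * (α i + β i - α i * β i))
    let PB := ∏ i ∈ S, (1 - β i * (α i + γ i - α i * γ i))
    let PC := ∏ i ∈ S, (1 - α i * (β i + γ i - β i * γ i))
    2 * ((1 - pab) * (1 - pac) * (1 - pbc) * PQ) - (1 - pac) * (1 - pbc) * PA ≤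
      ((1 - pab) * (1 - pbc) * PB + (1 - pab) * (1 - pac) * PC - (1 - pac) * (1 - pbc) * PA) *
        ((1 - pac) * (1 - pbc) * PA + (1 - pab) * (1 - pbc) * PB + (1 - pab) * (1 - pac) * PC -
          2 * ((1 - pab) * (1 - pac) * (1 - pbc) * PQ)) := by
  intro PQ PA PB PC
  have h0 := inv_prod S α β γ h01
  -- edge `ab` = hub `(pab, 1, 0)`
  have h1 := inv_step h0 hpab hpab1 zero_le_one le_rfl le_rfl zero_le_one
  -- edge `ac` = hub `(pac, 0, 1)`
  have h2 := inv_step h1 hpac hpac1 le_rfl zero_le_one zero_le_one le_rfl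
  -- edge `bc` = hub `(0, pbc, 1)`
  have h3 := inv_step h2 le_rfl zero_le_one hpbc hpbc1 zero_le_one le_rfl
  have h := h3.2.2.2.2.2.1
  have e1 : PQ * (1 - pab * 1 - pab * 0 - 1 * 0 + 2 * pab * 1 * 0) * (1 - pac * 0 - pac * 1 - 0 * 1 + 2 * pac * 0 * 1) *
      (1 - 0 * pbc - 0 * 1 - pbc * 1 + 2 * 0 * pbc * 1) = (1 - pab) * (1 - pac) * (1 - pbc) * PQ := by ring
  have e2 : PA * (1 - 0 * (pab + 1 - pab * 1)) * (1 - 1 * (pac + 0 - pac * 0)) * (1 - 1 * (0 + pbc - 0 * pbc)) =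
      (1 - pac) * (1 - pbc) * PA := by ring
  have e3 : PB * (1 - 1 * (pab + 0 - pab * 0)) * (1 - 0 * (pac + 1 - pac * 1)) * (1 - pbc * (0 + 1 - 0 * 1)) =
      (1 - pab) * (1 - pbc) * PB := by ring
  have e4 : PC * (1 - pab * (1 + 0 - 1 * 0)) * (1 - pac * (0 + 1 - 0 * 1)) * (1 - 0 * (pbc + 1 - pbc * 1)) =
      (1 - pab) * (1 - pac) * PC := by ring
  rw [e1, e2, e3, e4] at h
  exact h

end products

end Summit.CriticalPhenomena.PercolationContinuityZ3.Theorems.ThreePointPlusIsoProduct
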